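import Summits.Ventures.HodgeRepro.Night4ReducedDimEight

/-!
# `dim B_red` class by class: the first-representative formula

Blind re-derivation cell `pub-hodge-repro`, seat `night-4` (ROUTE HARDENING for the Monday FINAL, gen 5).  Target tree
path `lean/Summits/Ventures/HodgeRepro/Night4ReducedDimClasses.lean`.

`redDim T` (`Night4ReducedDimSix.lean`) sums `simpleDim` over the DISTINCT isogeny classes of the four corners, the
classes being the right-translation orbits `rclass (T i) = {T i · h : h ∈ G}`: on the kernel that builds four orbits of
`|G|` types each and de-duplicates pairs of orbits — at `|G| = 12` about 1200 comparisons of 6-element types per face,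
too slow for the `decide +kernel` of a whole degree-12 table (gen 4's ADDENDUM 3).  This file proves the formula the
route uses in §1 row S3ᴿ («the corners sorted into isogeny classes A_1, …, A_m»; ROUTE.md §3.3–§3.4 «(2,6,6)», «(3,3,3,3)»,
…): sum `simpleDim` over the corners that are the FIRST of their class,

* `SameClass S T := ∃ h, rmul S h = T` — the same isogeny class (`rclass_eq_iff`: `rclass S = rclass T ↔ SameClass S T`);
  an equivalence relation (`SameClass.refl` / `.symm` / `.trans`);
* `simpleDim_rmul`: the dimension of the simple factor is constant on a class (the right stabiliser of a twist is a
  conjugate subgroup, `mem_rstab_rmul_iff`);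
* `IsFirst T i := ∀ j < i, ¬ SameClass (T j) (T i)` and `redDimFirst T := Σ_i [IsFirst T i] · simpleDim (T i)`;
* **`redDim_eq_redDimFirst : redDim T = redDimFirst T`** (`Finset.sum_image'` fibre by fibre: every class has exactly
  one first index, its minimum).

With it a face costs about 120 comparisons of types on the kernel (`Night4ReducedDimTwelve*.lean`).  Nothing here says
anything about the status of the Hodge conjecture for CM abelian varieties, which is NOT proved.
-/

set_option autoImplicit false

open Finset

namespace HodgeRepro

section Classes

variable {G : Type} [Group G]

/-- `T` is a right translate of `S` — the corners `A_S`, `A_T` are in the same isogeny class. -/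
def SameClass (S T : Finset G) : Prop := ∃ h : G, rmul S h = T

/-- `SameClass` is reflexive. -/
theorem SameClass.refl (S : Finset G) : SameClass S S := ⟨1, rmul_one S⟩

/-- `SameClass` is symmetric. -/
theorem SameClass.symm {S T : Finset G} (h : SameClass S T) : SameClass T S := by
  obtain ⟨k, rfl⟩ := h
  exact ⟨k⁻¹, rmul_inv_rmul S k⟩

/-- `SameClass` is transitive. -/
theorem SameClass.trans {S T U : Finset G} (h₁ : SameClass S T) (h₂ : SameClass T U) : SameClass S U := by
  obtain ⟨k, rfl⟩ := h₁
  obtain ⟨l, rfl⟩ := h₂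
  exact ⟨k * l, (rmul_rmul S k l).symm⟩

/-- The right stabiliser of a twist is a conjugate: `k ∈ rstab (S h) ↔ h k h⁻¹ ∈ rstab S`. -/
theorem mem_rstab_rmul_iff (S : Finset G) (h k : G) : k ∈ rstab (rmul S h) ↔ h * k * h⁻¹ ∈ rstab S := by
  simp only [mem_rstab, rmul_rmul]
  constructor
  · intro e
    have := congrArg (fun X => rmul X h⁻¹) e
    simp only [rmul_rmul] at this
    rwa [mul_inv_cancel, rmul_one] at this
  · intro e
    have := congrArg (fun X => rmul X h) e
    simp only [rmul_rmul] at this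
    rwa [inv_mul_cancel_right] at this

variable [Fintype G] [DecidableEq G]

/-- `SameClass` is decidable on a finite group. -/
instance (S T : Finset G) : Decidable (SameClass S T) := by
  unfold SameClass
  infer_instance

/-- Membership in the right-translation class. -/
theorem mem_rclass {S T : Finset G} : T ∈ rclass S ↔ SameClass S T := by
  simp only [rclass, mem_image, mem_univ, true_and, SameClass]

/-- Two types have the same right-translation class iff one is a right translate of the other. -/
theorem rclass_eq_iff {S T : Finset G} : rclass S = rclass T ↔ SameClass S T := by
  constructor
  · intro e
    rw [← mem_rclass, e, mem_rclass]
    exact SameClass.refl T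
  · intro h
    ext X
    rw [mem_rclass, mem_rclass]
    exact ⟨fun h' => h.symm.trans h', fun h' => h.trans h'⟩

/-- The dimension of the simple factor is constant on an isogeny class. -/
theorem simpleDim_rmul (S : Finset G) (h : G) : simpleDim (rmul S h) = simpleDim S := by
  have e : Fintype.card (rstab (rmul S h)) = Fintype.card (rstab S) :=
    Fintype.card_congr (Equiv.subtypeEquiv (MulAut.conj h).toEquiv fun k => by
      rw [mem_rstab_rmul_iff]
      rfl)
  unfold simpleDim
  rw [e]

/-- `simpleDim` is constant on a class. -/
theorem SameClass.simpleDim_eq {S T : Finset G} (h : SameClass S T) : simpleDim S = simpleDim T := by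
  obtain ⟨k, rfl⟩ := h
  exact (simpleDim_rmul S k).symm

/-- The class datum `(rclass, simpleDim)` of two corners agrees iff they are in the same class. -/
theorem classDatum_eq_iff {S T : Finset G} :
    (rclass S, simpleDim S) = (rclass T, simpleDim T) ↔ SameClass S T := by
  rw [Prod.mk.injEq, rclass_eq_iff]
  exact ⟨fun h => h.1, fun h => ⟨h, h.simpleDim_eq⟩⟩

/-- `i` is the first index of its isogeny class among the four corners. -/
def IsFirst (T : Fin 4 → Finset G) (i : Fin 4) : Prop := ∀ j : Fin 4, j < i → ¬ SameClass (T j) (T i)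

/-- `IsFirst` is decidable. -/
instance (T : Fin 4 → Finset G) : DecidablePred (IsFirst T) := fun i => by
  unfold IsFirst
  infer_instance

/-- The reduced dimension summed over the first representatives of the classes. -/
def redDimFirst (T : Fin 4 → Finset G) : ℕ := ∑ i : Fin 4, if IsFirst T i then simpleDim (T i) else 0

/-- **The first-representative formula**: `redDim T = redDimFirst T`. -/
theorem redDim_eq_redDimFirst (T : Fin 4 → Finset G) : redDim T = redDimFirst T := by
  unfold redDim redDimFirst
  refine Finset.sum_image' (fun i => if IsFirst T i then simpleDim (T i) else 0) fun i _ => ?_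
  -- the fibre of `i`: the indices in the class of `i`
  have hfib : ∀ j : Fin 4, j ∈ univ.filter (fun j : Fin 4 =>
      (rclass (T j), simpleDim (T j)) = (rclass (T i), simpleDim (T i))) ↔ SameClass (T j) (T i) := by
    intro j
    rw [mem_filter, classDatum_eq_iff]
    exact ⟨fun h => h.2, fun h => ⟨mem_univ j, h⟩⟩
  set fib := univ.filter (fun j : Fin 4 =>
    (rclass (T j), simpleDim (T j)) = (rclass (T i), simpleDim (T i))) with hfibdef
  have hi : i ∈ fib := (hfib i).2 (SameClass.refl (T i))
  set m := fib.min' ⟨i, hi⟩ with hm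
  have hmmem : m ∈ fib := Finset.min'_mem fib ⟨i, hi⟩
  have hmi : SameClass (T m) (T i) := (hfib m).1 hmmem
  -- the first index of the class is its minimum and nothing else
  have hfirst : ∀ j ∈ fib, IsFirst T j ↔ j = m := by
    intro j hj
    have hji : SameClass (T j) (T i) := (hfib j).1 hj
    constructor
    · intro hf
      have hle : m ≤ j := Finset.min'_le fib j hj
      rcases lt_or_eq_of_le hle with hlt | heq
      · exact absurd (hmi.trans hji.symm) (hf m hlt)
      · exact heq.symm
    · rintro rfl k hk hkm
      have hkfib : k ∈ fib := (hfib k).2 (hkm.trans hmi)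
      exact absurd (Finset.min'_le fib k hkfib) (not_le.2 hk)
  show simpleDim (T i) = ∑ j ∈ fib, if IsFirst T j then simpleDim (T j) else 0
  rw [Finset.sum_eq_single m]
  · rw [if_pos ((hfirst m hmmem).2 rfl)]
    exact hmi.simpleDim_eq.symm
  · intro b hb hbm
    exact if_neg fun hf => hbm ((hfirst b hb).1 hf)
  · intro h
    exact absurd hmmem h

end Classes

end HodgeRepro
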